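import Summits.ResolutionOfSingularities.ResolutionOfSingularities.Theorems.MarkedTransferCampaignW46TameConeRidge
import Literature.AlgebraicGeometry.Resolution.RidgeEdgeDatumLinear
import Literature.AlgebraicGeometry.Resolution.DirectrixEqualDegree
import HarnessLib

/-!
# [OURS · L1 W4.6, rung (iv) «large characteristic»] In regime (iv) of the TYPED procedure, at every point of every state,
# Hironaka's edge datum of the ridge of the tangent cone is `(1, …, 1)`, `Rid = Dir` as subschemes, and
# `dim Rid = dim Dir`; in every regime `dim Rid = n − r`
# (cell res-hironaka, LADDER-RESOLUTION rung L, D-0089; slot W4.6, seat res-L1-s46-pv-7 gen 3; host route MarkedTransfer,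
# `--supports stmt-ResolutionOfSingularities-16155 --as helper`)

HONEST FRAMING. Nothing here is a statement of H. Hironaka's manuscript (2017-03-23, [Hironaka2017]) and nothing here
asserts that any statement of it holds. OURS corollaries, over the shared typed-procedure module
`MarkedTransferCampaignW46TypedProcedure` (res-L1-type-o1: `CampaignW46.Regime.charGT`, `AmbientDatum`, `IdealExponent`
— typed CANDIDATE carriers used as definitions), the TREE's cone vocabulary (`initialForms c J μ` = `cl_μ(J)`;
`ridge`, `ridgeIdeal`, `ridgeDim`, `directrixSpace`, `directrixDim`; Hironaka's edge datum of the ridge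
`ridgeEdgeInv p I = (q₁ ≤ … ≤ q_r)` and Frühbis-Krüger's indicator `RidgeGeneratedInDegreeOne`), and this seat's
Literature landings of gen 3 (`RidgeDirectrixTame`, `RidgeDimension`, `RidgeEdgeDatumLinear`, `DirectrixEqualDegree`).
The manuscript's `Inv` (Eq. (34) p.24) enters only as the tree's DEFINITION `ridgeEdgeInv`. No premise of the
manuscript, no FACT-LIST premise. AI review is weaker than expert review. No `sorry`, no new definition; axioms
standard.

## What this file adds (after `TameRegime` p483854 — Dir, `τ` first-order — and `TameConeRidge` p505389 — Rid linear)

For a state `(A, E)` of the typed procedure, a point `ξ` whose local ring has characteristic `p`, coordinates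
`c_1, …, c_d ∈ 𝒪_{Z,ξ}`, and the cone `C_ξ = V(cl_b(J_ξ))` of the order-`b` initial forms of `J_ξ = stalkIdeal E.J ξ`:
* EVERY regime: `ridgeDim_tangentCone_stalk_eq_sub_r` — `dim Rid(C_ξ) = d − r` with `r` the number of exponents of
  Hironaka's edge datum of the ridge (the tree's `RidgeDimension`); `directrixSpace_tangentCone_stalk_eq_map_directrix`
  — the CJS directrix space of the cone ideal is Hironaka's `T(cl_b(J_ξ))`, so `e = d − τ_ξ` (`DirectrixEqualDegree`);
* REGIME (iv), `E.b < p`: `ridgeGeneratedInDegreeOne_tangentCone_stalk` — **the edge datum of the ridge of `C_ξ` is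
  `(1, …, 1)`** (Frühbis-Krüger's indicator of characteristic-`p` behaviour never fires in regime (iv));
  `ridgeIdeal_tangentCone_stalk_eq_span_directrixSpace` — **`Rid(C_ξ) = Dir(C_ξ)` as subschemes of the tangent space**;
  `ridgeDim_tangentCone_stalk_eq_directrixDim` — `dim Rid(C_ξ) = dim Dir(C_ξ) = e`; and
  `ridgeEdgeInv_r_tangentCone_stalk_eq_hironakaTauAt` — `r = τ_ξ(J_ξ, b)` (the number of ridge exponents is Hironaka's
  `τ`). With p483854/p505389: in regime (iv) the whole tangent-cone layer of the procedure (Dir, `τ`, Rid, edge datum) is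
  the characteristic-zero one.

## References (context; nothing is cited as a premise)

* this seat's p506201 `RidgeDirectrixTame`, p507298 `RidgeDimension`, `RidgeEdgeDatumLinear`, p509003
  `DirectrixEqualDegree`; p483854 `TameRegime`, p505389 `TameConeRidge`.
* A. Frühbis-Krüger, J. Singul. 2 (2010), §2. [cite: FruehbisKrueger2010, §2]
* Cossart–Jannsen–Saito, LNM 2270, Rem. 18.29. [cite: CossartJannsenSaito2020, Remark 18.29]
-/

noncomputable section

set_option linter.dupNamespace false -- mandated namespace of this single-conjunct summit

open CategoryTheory AlgebraicGeometry TopologicalSpace IsLocalRing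

namespace Summit.ResolutionOfSingularities.ResolutionOfSingularities.Theorems
namespace CampaignW46
namespace TameConeEdgeDatum

open MvPolynomial
open Literature.AlgebraicGeometry.Resolution
open Literature.AlgebraicGeometry.Hironaka2017.S02Preliminaries
open Literature.AlgebraicGeometry.Hironaka2017.Datum
open Literature.RingTheory.MvPolynomial (isHomogeneousIdeal_span_of_isHomogeneous directrixSpace directrixDim)

universe u

/-! ## Ring level: the cone of the initial forms of an ideal of a local ring -/

section LocalRing

variable {R : Type u} [CommRing R] [IsLocalRing R] {d : ℕ} (c : Fin d → R)

/-- [OURS · L1 W4.6 (iv); NOT a statement of the manuscript] **Every characteristic: `dim Rid(V(cl_μ(J))) = d − r`**,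
`r` the number of exponents of Hironaka's edge datum of the ridge (`RidgeDimension.ridgeDim_eq_sub_ridgeEdgeInv_r`; the
ideal spanned by the initial forms of order `μ` is homogeneous). [folklore] -/
theorem ridgeDim_initialForms_eq_sub_r (p : ℕ) [ExpChar (ResidueField R) p] (J : Ideal R) (μ : ℕ) :
    ridgeDim (Ideal.span (initialForms c J μ : Set (MvPolynomial (Fin d) (ResidueField R)))) =
      d - (ridgeEdgeInv p (Ideal.span (initialForms c J μ : Set (MvPolynomial (Fin d) (ResidueField R))))).r :=
  ridgeDim_eq_sub_ridgeEdgeInv_r p _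
    (isHomogeneousIdeal_span_of_isHomogeneous fun _ hG => ⟨μ, isHomogeneous_of_mem_initialForms c hG⟩)

/-- [OURS · L1 W4.6 (iv); NOT a statement of the manuscript] **Every characteristic: the CJS directrix space of the cone
ideal `⟨cl_μ(J)⟩` is Hironaka's directrix `T(cl_μ(J))`** (`DirectrixEqualDegree`), so `e(S/⟨cl_μ(J)⟩) = d − τ_μ(J)`.
[folklore] -/
theorem directrixSpace_initialForms_eq_map_directrix (J : Ideal R) (μ : ℕ) :
    directrixSpace (Ideal.span (initialForms c J μ : Set (MvPolynomial (Fin d) (ResidueField R)))) =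
      (directrix (ResidueField R) (initialForms c J μ : Set (MvPolynomial (Fin d) (ResidueField R)))).map
        (linearFormPolyₗ (ResidueField R)) :=
  directrixSpace_span_eq_map_directrix_of_forall_isHomogeneous fun _ hG => isHomogeneous_of_mem_initialForms c hG

/-- [OURS · L1 W4.6 (iv); NOT a statement of the manuscript] **Every characteristic: `e(S/⟨cl_μ(J)⟩) = d − τ_μ(J)`**
(`directrixDim` of the cone ideal vs the tree's `hironakaTauAt`). [folklore] -/
theorem directrixDim_initialForms_eq_sub_hironakaTauAt (J : Ideal R) (μ : ℕ) :
    directrixDim (Ideal.span (initialForms c J μ : Set (MvPolynomial (Fin d) (ResidueField R)))) =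
      d - hironakaTauAt c J μ :=
  directrixDim_span_eq_sub_hironakaTau fun _ hG => isHomogeneous_of_mem_initialForms c hG

/-- [OURS · L1 W4.6 (iv); NOT a statement of the manuscript] **Tame order: the edge datum of the ridge of `V(cl_μ(J))`
is `(1, …, 1)`** whenever `1, …, μ` are non-zero in the residue field (`RidgeEdgeDatumLinear`). [folklore] -/
theorem ridgeGeneratedInDegreeOne_initialForms (p : ℕ) [ExpChar (ResidueField R) p] (J : Ideal R) {μ : ℕ}
    (hchar : ∀ m : ℕ, 1 ≤ m → m ≤ μ → (m : ResidueField R) ≠ 0) :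
    RidgeGeneratedInDegreeOne
      (ridgeEdgeInv p (Ideal.span (initialForms c J μ : Set (MvPolynomial (Fin d) (ResidueField R))))) :=
  ridgeGeneratedInDegreeOne_span_of_tame p (fun _ hG => isHomogeneous_of_mem_initialForms c hG) hchar

/-- [OURS · L1 W4.6 (iv); NOT a statement of the manuscript] **Tame order: `Rid = Dir` as subschemes** for the cone
`V(cl_μ(J))`: the ridge ideal is the ideal generated by the CJS directrix space (`RidgeDirectrixTame`). [folklore] -/
theorem ridgeIdeal_initialForms_eq_span_directrixSpace (J : Ideal R) {μ : ℕ}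
    (hchar : ∀ m : ℕ, 1 ≤ m → m ≤ μ → (m : ResidueField R) ≠ 0) :
    ridgeIdeal (Ideal.span (initialForms c J μ : Set (MvPolynomial (Fin d) (ResidueField R)))) =
      Ideal.span (directrixSpace (Ideal.span (initialForms c J μ : Set (MvPolynomial (Fin d) (ResidueField R)))) :
        Set (MvPolynomial (Fin d) (ResidueField R))) :=
  ridgeIdeal_span_eq_span_directrixSpace (fun _ hG => isHomogeneous_of_mem_initialForms c hG) hchar

/-- [OURS · L1 W4.6 (iv); NOT a statement of the manuscript] **Tame order: `dim Rid = dim Dir`** for the cone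
`V(cl_μ(J))`. [folklore] -/
theorem ridgeDim_initialForms_eq_directrixDim (J : Ideal R) {μ : ℕ}
    (hchar : ∀ m : ℕ, 1 ≤ m → m ≤ μ → (m : ResidueField R) ≠ 0) :
    ridgeDim (Ideal.span (initialForms c J μ : Set (MvPolynomial (Fin d) (ResidueField R)))) =
      directrixDim (Ideal.span (initialForms c J μ : Set (MvPolynomial (Fin d) (ResidueField R)))) :=
  ridgeDim_span_eq_directrixDim (fun _ hG => isHomogeneous_of_mem_initialForms c hG) hchar

/-- [OURS · L1 W4.6 (iv); NOT a statement of the manuscript] **Tame order: the number `r` of ridge exponents equals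
Hironaka's `τ_μ(J)`** (`r = dim 𝒯(⟨cl_μ(J)⟩) = τ(cl_μ(J))`). [folklore] -/
theorem ridgeEdgeInv_r_initialForms_eq_hironakaTauAt (p : ℕ) [ExpChar (ResidueField R) p] (J : Ideal R) {μ : ℕ}
    (hchar : ∀ m : ℕ, 1 ≤ m → m ≤ μ → (m : ResidueField R) ≠ 0) :
    (ridgeEdgeInv p (Ideal.span (initialForms c J μ : Set (MvPolynomial (Fin d) (ResidueField R))))).r =
      hironakaTauAt c J μ := by
  rw [ridgeEdgeInv_r_span_eq_finrank_directrixSpace p (fun _ hG => isHomogeneous_of_mem_initialForms c hG) hchar,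
    hironakaTauAt, finrank_directrixSpace_span_eq_hironakaTau_of_forall
      (fun _ hG => isHomogeneous_of_mem_initialForms c hG)]

end LocalRing

/-! ## Typed level: regime (iv) of the shared module, `E.b < p` -/

section Typed

variable {n : ℕ} {p : ℕ} [Fact p.Prime] {K : Type u} [Field K] [CharP K p]

/-- The residue fields of the local rings of characteristic `p` have exponential characteristic `p`. [folklore] -/
theorem expChar_residueField {R : Type u} [CommRing R] [IsLocalRing R] (hp : CharP R p) :
    ExpChar (ResidueField R) p :=
  haveI := TameRegime.charP_residueField (R := R) p
  ExpChar.prime (Fact.out : p.Prime)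

/-- [OURS · L1 W4.6 (iv); NOT a statement of the manuscript] **Regime (iv): at every point of every state the edge
datum of the ridge of the tangent cone is `(1, …, 1)`** — for `(A, E)` in `Regime.charGT n (fun _ b ↦ b)` (`E.b < p`),
`ξ ∈ Z` with `CharP (𝒪_{Z,ξ}) p`, `c_1, …, c_d ∈ 𝒪_{Z,ξ}`:
`RidgeGeneratedInDegreeOne (ridgeEdgeInv p ⟨cl_b(J_ξ)⟩)`. [folklore] -/
theorem ridgeGeneratedInDegreeOne_tangentCone_stalk (A : AmbientDatum p K) (E : IdealExponent A.Z)
    (hE : Regime.charGT (p := p) (K := K) n (fun _ b => b) A E) (ξ : A.Z) (hp : CharP (A.Z.presheaf.stalk ξ) p)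
    {d : ℕ} (c : Fin d → A.Z.presheaf.stalk ξ) :
    haveI := expChar_residueField (p := p) hp
    RidgeGeneratedInDegreeOne (ridgeEdgeInv p (Ideal.span (initialForms c (stalkIdeal E.J ξ) E.b :
      Set (MvPolynomial (Fin d) (ResidueField (A.Z.presheaf.stalk ξ)))))) := by
  haveI := hp
  haveI := TameRegime.charP_residueField (R := A.Z.presheaf.stalk ξ) p
  exact ridgeGeneratedInDegreeOne_initialForms c p (stalkIdeal E.J ξ) (TamePolar.natCast_ne_zero_of_lt_char p hE)

/-- [OURS · L1 W4.6 (iv); NOT a statement of the manuscript] **Regime (iv): `Rid = Dir` as subschemes of the tangent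
space at every point of every state.** [folklore] -/
theorem ridgeIdeal_tangentCone_stalk_eq_span_directrixSpace (A : AmbientDatum p K) (E : IdealExponent A.Z)
    (hE : Regime.charGT (p := p) (K := K) n (fun _ b => b) A E) (ξ : A.Z) (hp : CharP (A.Z.presheaf.stalk ξ) p)
    {d : ℕ} (c : Fin d → A.Z.presheaf.stalk ξ) :
    ridgeIdeal (Ideal.span (initialForms c (stalkIdeal E.J ξ) E.b :
        Set (MvPolynomial (Fin d) (ResidueField (A.Z.presheaf.stalk ξ))))) =
      Ideal.span (directrixSpace (Ideal.span (initialForms c (stalkIdeal E.J ξ) E.b :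
        Set (MvPolynomial (Fin d) (ResidueField (A.Z.presheaf.stalk ξ))))) :
          Set (MvPolynomial (Fin d) (ResidueField (A.Z.presheaf.stalk ξ)))) := by
  haveI := hp
  haveI := TameRegime.charP_residueField (R := A.Z.presheaf.stalk ξ) p
  exact ridgeIdeal_initialForms_eq_span_directrixSpace c (stalkIdeal E.J ξ) (TamePolar.natCast_ne_zero_of_lt_char p hE)

/-- [OURS · L1 W4.6 (iv); NOT a statement of the manuscript] **Regime (iv): `dim Rid = dim Dir`** for the tangent cone at
every point of every state. [folklore] -/
theorem ridgeDim_tangentCone_stalk_eq_directrixDim (A : AmbientDatum p K) (E : IdealExponent A.Z)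
    (hE : Regime.charGT (p := p) (K := K) n (fun _ b => b) A E) (ξ : A.Z) (hp : CharP (A.Z.presheaf.stalk ξ) p)
    {d : ℕ} (c : Fin d → A.Z.presheaf.stalk ξ) :
    ridgeDim (Ideal.span (initialForms c (stalkIdeal E.J ξ) E.b :
        Set (MvPolynomial (Fin d) (ResidueField (A.Z.presheaf.stalk ξ))))) =
      directrixDim (Ideal.span (initialForms c (stalkIdeal E.J ξ) E.b :
        Set (MvPolynomial (Fin d) (ResidueField (A.Z.presheaf.stalk ξ))))) := by
  haveI := hp
  haveI := TameRegime.charP_residueField (R := A.Z.presheaf.stalk ξ) p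
  exact ridgeDim_initialForms_eq_directrixDim c (stalkIdeal E.J ξ) (TamePolar.natCast_ne_zero_of_lt_char p hE)

/-- [OURS · L1 W4.6 (iv); NOT a statement of the manuscript] **Regime (iv): the number of ridge exponents is Hironaka's
`τ`**: `r = τ_ξ(J_ξ, b)` at every point of every state. [folklore] -/
theorem ridgeEdgeInv_r_tangentCone_stalk_eq_hironakaTauAt (A : AmbientDatum p K) (E : IdealExponent A.Z)
    (hE : Regime.charGT (p := p) (K := K) n (fun _ b => b) A E) (ξ : A.Z) (hp : CharP (A.Z.presheaf.stalk ξ) p)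
    {d : ℕ} (c : Fin d → A.Z.presheaf.stalk ξ) :
    haveI := expChar_residueField (p := p) hp
    (ridgeEdgeInv p (Ideal.span (initialForms c (stalkIdeal E.J ξ) E.b :
      Set (MvPolynomial (Fin d) (ResidueField (A.Z.presheaf.stalk ξ)))))).r = hironakaTauAt c (stalkIdeal E.J ξ) E.b := by
  haveI := hp
  haveI := TameRegime.charP_residueField (R := A.Z.presheaf.stalk ξ) p
  exact ridgeEdgeInv_r_initialForms_eq_hironakaTauAt c p (stalkIdeal E.J ξ) (TamePolar.natCast_ne_zero_of_lt_char p hE)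

/-- [OURS · L1 W4.6 (iv); NOT a statement of the manuscript] **Every regime: `dim Rid = d − r`** for the tangent cone at
every point whose local ring has characteristic `p`. [folklore] -/
theorem ridgeDim_tangentCone_stalk_eq_sub_r (A : AmbientDatum p K) (E : IdealExponent A.Z) (ξ : A.Z)
    (hp : CharP (A.Z.presheaf.stalk ξ) p) {d : ℕ} (c : Fin d → A.Z.presheaf.stalk ξ) :
    haveI := expChar_residueField (p := p) hp
    ridgeDim (Ideal.span (initialForms c (stalkIdeal E.J ξ) E.b :
        Set (MvPolynomial (Fin d) (ResidueField (A.Z.presheaf.stalk ξ))))) =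
      d - (ridgeEdgeInv p (Ideal.span (initialForms c (stalkIdeal E.J ξ) E.b :
        Set (MvPolynomial (Fin d) (ResidueField (A.Z.presheaf.stalk ξ)))))).r := by
  haveI := expChar_residueField (p := p) hp
  exact ridgeDim_initialForms_eq_sub_r c p (stalkIdeal E.J ξ) E.b

end Typed

end TameConeEdgeDatum
end CampaignW46
end Summit.ResolutionOfSingularities.ResolutionOfSingularities.Theorems

end
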